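import Literature.Probability.RandomPlanarGeometry.HexSAWArmchairSqrtStrict
import Literature.Probability.RandomPlanarGeometry.HexSAWRotSurfaceMuSqrtAsymptotic
import HarnessLib

/-!
# Beaton's ROTATED (armchair) honeycomb surface, brick-wall frame: the second-order term of the wall-bridge growth rate from BELOW —
# `B^w_{4k+1}(y) ≥ y^{2k+2} + 2(k−1)·y^{2k}`, hence `y (β_rot(y)² − y) ≥ 1 − 2/m − (2m+1)/y²` for every `m ≥ 2`, `y ≥ 1`:
# `liminf_{y→∞} y (β_rot(y)² − y) ≥ 1` (with «ARM-SECOND-ORDER-UPPER»'s `limsup ≤ 1`: the coefficient is exactly `1` — assembled in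
# «ARM-SECOND-ORDER-EXACT»); the same for `μ_rot = HV.rotSurfaceMu` (`y ≥ 4`)

Topic `Literature/Probability/RandomPlanarGeometry` (lane «pcv-sawmu», car «ARM-SECOND-ORDER-LOWER», a-p6 g15; continues
`HexSAWArmchairSqrtStrict.lean` (the explicit length-`13` bridges `zw`, `dw`: `β_rot¹⁶ ≥ y⁸(1 + y⁻²)`), `HexSAWArmchairWallBridges.lean`
(`Arm.WB`, `Arm.wseq_le_pow : B^w_{4k−3} ≤ β_rot^{4k}`, `Arm.zz`/`zzWalk`) and `HexSAWRotSurfaceMuSqrtAsymptotic.lean`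
(`HV.rotSurfaceMu_eq_armRate_of_four_le`); its companion from ABOVE is `HexSAWArmchairSecondOrder.lean` («ARM-SECOND-ORDER-UPPER»:
`Arm.mul_armRate_sq_sub_le : y(β_rot² − y) ≤ 1 + 7655/√y`, not imported here).

Sources.  N. R. Beaton, *The critical surface fugacity of self-avoiding walks on a rotated honeycomb lattice*, CMP 326 (2014) 727 =
arXiv:1210.0274v3, §1 (p. 2, Fig. 1(b): the rotated surface model), §3–§3.1 (p. 11; Proposition 7: `μ(y)`), p. 12 (unfolded walks), p. 14 ("walks which step along the surface").
N. Madras, G. Slade, *The Self-Avoiding Walk* (1993), §1.2 (Lemma 1.2.2, (1.2.17): `b_n ≤ μ^n`).  I. G. Enting, I. Jensen, LNP 775 (2009),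
§7.4.2, Fig. 7.10 (brickwork form of the honeycomb lattice).

## What is proved (namespace `…SAW.HexBW.Arm`, explicit walks in `Arm.Defect`)

* §1–§2 CLOSED-FORM explicit walks for EVERY length `4k+1`, built on the tree's dimer zig-zag `Arm.zz` / `Arm.zzWalk`
  (`HexSAWArmchairWallBridges`; closed forms `zz_X : X = ⌊(i mod 4)/2⌋`, `zz_Y : Y = 2⌊i/4⌋ + ⌊((i mod 4)+1)/2⌋`): the two ONE-DEFECT families `skipW n j` (the «skip a dimer» excursion
  `(1,Y)(1,Y+1)(2,Y+1)(2,Y+2)(1,Y+2)(1,Y+3)(0,Y+3)` launched from the dimer top `(0, 2j+1)` — it lands back ON the zig-zag schedule) and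
  `wideW n j` (the «wide connector» `(1,Y)(2,Y)(3,Y)(3,Y+1)(2,Y+1)(1,Y+1)(0,Y+1)` — four steps behind schedule afterwards); adjacency,
  injectivity, wall times and `visits` in closed form (`omega` on `⌊i/4⌋`, `i mod 4`).
* §3 `skipW_mem_wb`, `wideW_mem_wb` (`j + 2 ≤ k`; with the tree's `zzWalk_mem_wb`): wall bridges of length `4k+1`; `visits_zzWalk = 2k+2`,
  `visits_skipW = visits_wideW = 2k`.
* §4 ★★ **`Defect.WB_ge_defect (1 ≤ k) : y^{2k+2} + 2(k−1)·y^{2k} ≤ B^w_{4k+1}(y)`** (`2(k−1)+1` pairwise distinct bridges).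
* §5 `pow_mul_le_armRate_pow : y^{2k}(y² + 2(k−1)) ≤ (β_rot⁴)^{k+1}`; `root_extraction` (`B^m ≥ Y^m(1+x)`, `0 ≤ x ≤ 1 ⇒ B ≥ Y(1 + (x−x²)/m)`,
  via `(1+t)^m ≤ e^{mt}` and `|e^u − 1 − u| ≤ u²`); `armRate_pow_four_ge : β_rot⁴ ≥ y² + 2(m−2)/m − 4(m−2)²/(m y²)` (`y² ≥ 2(m−2)`);
  ★★★ **`mul_armRate_sq_sub_ge (1 ≤ y) (2 ≤ m) : 1 − 2/m − (2m+1)/y² ≤ y (β_rot(y)² − y)`**;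
  ★★★ `eventually_mul_armRate_sq_sub_ge : ∀ ε > 0, eventually 1 − ε ≤ y(β_rot² − y)` (liminf ≥ 1);
  ★ `pow_add_four_mul_pow_le_WB_thirteen : y⁸ + 4y⁶ ≤ B^w_13(y)` (the census `B^w_13 = y⁸ + 4y⁶ + 8y⁴` of `HexSAWArmchairSqrtStrict`).
* §6 (the NEXT seed, groundwork for the third order) the two NINE-step defects `Defect.nineA`/`nineB` (`(1,Y)(2,Y)(3,Y)(3,Y+1)(2,Y+1)(2,Y+2)
  (1,Y+2)(1,Y+3)(0,Y+3)` and `(1,Y)(1,Y+1)(2,Y+1)(2,Y+2)(3,Y+2)(3,Y+3)(2,Y+3)(1,Y+3)(0,Y+3)`, landing on a dimer BOTTOM two steps behind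
  schedule) are wall bridges of length `4k+3` with `2k` visits; ★★ **`Defect.WB_ge_nine_defect : 2(k−1)·y^{2k} ≤ B^w_{4k+3}(y)`** — the top
  coefficient of the odd class (`B^w_11 = 2y⁴`, `B^w_15 = 4y⁶ + …`: equality, a-ref-1 g56 census), i.e. the seed count `a₉↑ = 2` behind the
  conjectured third-order term `β_rot² = y + 1/y + 1/y² + O(y⁻³)` (NOT claimed); `two_mul_pow_four_le_WB_eleven`.
* §7 the transfer to Beaton's `μ_rot(y) = HV.rotSurfaceMu y` (`= β_rot(y)` for `y ≥ 4`, `HexSAWRotSurfaceMuSqrtAsymptotic`):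
  ★★ `HV.mul_rotSurfaceMu_sq_sub_ge`, `HV.eventually_mul_rotSurfaceMu_sq_sub_ge` (liminf ≥ 1).  The two-sided statement
  `y (μ_rot(y)² − y) → 1` (with «ARM-SECOND-ORDER-UPPER») is the separate assembly car «ARM-SECOND-ORDER-EXACT»
  (`HexSAWArmchairSecondOrderExact.lean`).

MECHANISM.  Per period of the dimer zig-zag (`4` steps, `2` wall visits, weight `y²z⁴`) the cheapest defects are the two seven-step
excursions replacing a three-step connector (each loses `2` visits and `4` steps: relative weight `y⁻²` in the growth variable `β_rot⁴ ∼ y²`);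
`2(k−1)` of them at length `4k+1` give `β_rot^{4(k+1)} ≥ y^{2k}(y² + 2(k−1))`, and letting `k → ∞` slowly (`m = k+1 ∼ y^{2/3}`) recovers the
full coefficient: `liminf y(β_rot² − y) ≥ sup_m (1 − 2/m) = 1`, matching the two-step-alive upper bound.

HONEST LABEL (author's proposal).  LANE THEOREM (S) / NEW-IN-WRITING (modest, S): «for Beaton's rotated-honeycomb surface model,
liminf_{y→∞} y (μ_rot(y)² − y) ≥ 1» (and, with the UPPER car, `= 1`) — elementary, explicit; Beaton (2014) prints no large-fugacity expansion.  NOT CLAIMED: a rate better than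
`O(y^{-2/3})` from below (a seed-renewal inequality would give `O(y⁻²)`), anything at `y < 1` (resp. `y < 4` for `μ_rot`).
-/


noncomputable section

open Finset Filter Function
open Literature.Probability.LatticeModels Literature.Probability.Percolation SimpleGraph
open _root_.Topology

namespace Literature.Probability.RandomPlanarGeometry.SAW.HexBW.Arm

variable {y : ℝ} {n : ℕ}

namespace Defect

/-! ### §1  The dimer zig-zag pattern and the two one-defect families, in closed form -/

/-- `X`-offsets of the «skip a dimer» excursion `(1,Y)(1,Y+1)(2,Y+1)(2,Y+2)(1,Y+2)(1,Y+3)(0,Y+3)` at `d = 1, …, 7` (`Y`-offset `⌊d/2⌋`).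
[cite: EntingJensen2009, §7.4.2, Fig. 7.10 (brickwork form of the honeycomb lattice)] -/
def sX (d : ℕ) : ℕ := if d ≤ 2 then 1 else if d ≤ 4 then 2 else if d ≤ 6 then 1 else 0

/-- `X`-offsets of the «wide connector» excursion `(1,Y)(2,Y)(3,Y)(3,Y+1)(2,Y+1)(1,Y+1)(0,Y+1)` at `d = 1, …, 7` (`Y`-offset `⌊d/4⌋`).
[cite: EntingJensen2009, §7.4.2, Fig. 7.10] -/
def wX (d : ℕ) : ℕ := if d ≤ 3 then d else 7 - d

/-- **The «skip a dimer» one-defect bridge**: zig-zag up to the dimer top `(0, 2j+1)` (time `4j+1`), the seven-step excursion skipping the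
dimer `(0,2j+2)–(0,2j+3)`, landing at `(0,2j+4)` at time `4j+8` — back on the zig-zag schedule. [cite: Beaton2014RotatedHoneycomb, §3.1, proof of Proposition 7 (arXiv v3 p. 12: unfolded walks)] -/
def skipW (n j : ℕ) (i : ℕ) : Site 2 :=
  if min i n ≤ 4 * j + 1 ∨ 4 * j + 8 ≤ min i n then zz (min i n)
  else pt (sX (min i n - (4 * j + 1)) : ℤ) ((2 * j + 1 + (min i n - (4 * j + 1)) / 2 : ℕ) : ℤ)

/-- **The «wide connector» one-defect bridge**: zig-zag up to `(0, 2j+1)`, the seven-step excursion around the brick to the right, landing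
at `(0,2j+2)` at time `4j+8` — four steps behind the zig-zag schedule from then on. [cite: Beaton2014RotatedHoneycomb, §3.1, proof of Proposition 7 (arXiv v3 p. 12)] -/
def wideW (n j : ℕ) (i : ℕ) : Site 2 :=
  if min i n ≤ 4 * j + 1 then zz (min i n)
  else if min i n ≤ 4 * j + 7 then pt (wX (min i n - (4 * j + 1)) : ℤ) ((2 * j + 1 + (min i n - (4 * j + 1)) / 4 : ℕ) : ℤ)
  else zz (min i n - 4)

/-! ### §2  Coordinate facts (closed-form arithmetic, `omega`) -/

/-- Closed form of the tree's dimer zig-zag `Arm.zz` (`HexSAWArmchairWallBridges`): `X = ⌊(i mod 4)/2⌋`.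
[cite: Beaton2014RotatedHoneycomb, §3.1 (arXiv v3 p. 14: "walks which step along the surface")] -/
theorem zz_X (i : ℕ) : zz i 0 = ((i % 4 / 2 : ℕ) : ℤ) := by
  rw [zz_apply_zero]; split_ifs <;> push_cast <;> omega

/-- Closed form of `Arm.zz`: `Y = ⌊(i+1)/2⌋ = 2⌊i/4⌋ + ⌊((i mod 4)+1)/2⌋`. [cite: Beaton2014RotatedHoneycomb, §3.1 (arXiv v3 p. 14)] -/
theorem zz_Y (i : ℕ) : zz i 1 = ((2 * (i / 4) + (i % 4 + 1) / 2 : ℕ) : ℤ) := by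
  rw [zz_apply_one]; congr 1; omega

/-- The zig-zag is injective. [cite: EntingJensen2009, §7.4.2, Fig. 7.10] -/
theorem zz_inj {i i' : ℕ} (h0 : zz i 0 = zz i' 0) (h1 : zz i 1 = zz i' 1) : i = i' := by
  rw [zz_X] at h0; rw [zz_Y] at h1; rw [zz_X] at h0; rw [zz_Y] at h1; push_cast at h0 h1; omega

/-- Zig-zag wall times are `i ≡ 0, 1 (mod 4)`. [cite: Beaton2014RotatedHoneycomb, §3.1 (arXiv v3 p. 14)] -/
theorem zz_wall_iff (i : ℕ) : zz i 0 = 0 ↔ i % 4 < 2 := by rw [zz_X]; push_cast; omega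

/-- `visits` along the zig-zag: `2⌊i/4⌋ + 1 + min(i mod 4, 1)`. [cite: Beaton2014RotatedHoneycomb, §3.1 (arXiv v3 p. 11: "occupying m vertices in the surface")] -/
theorem visits_zz (i : ℕ) : visits i zz = 2 * (i / 4) + 1 + min (i % 4) 1 := by
  induction i with
  | zero => rw [visits_zero, if_pos ((zz_wall_iff 0).2 (by norm_num))]; norm_num
  | succ i ih =>
    rw [visits_succ, ih]
    by_cases h : zz (i + 1) 0 = 0
    · rw [if_pos h]; rw [zz_wall_iff] at h; omega
    · rw [if_neg h]; rw [zz_wall_iff] at h; omega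

/-- Steps of the skip-a-dimer bridge. [cite: EntingJensen2009, §7.4.2, Fig. 7.10] -/
theorem skipW_adj {n j i : ℕ} (hi : i < n) : brickWallGraph.Adj (skipW n j i) (skipW n j (i + 1)) := by
  rw [brickWallGraph_adj_coord]
  simp only [skipW, min_eq_left hi.le, min_eq_left (by omega : i + 1 ≤ n), sX]
  split_ifs <;> simp only [zz_X, zz_Y, pt_apply_zero, pt_apply_one] <;> push_cast <;>
    (try simp only [true_and, false_and, false_or, or_false, or_true]) <;> omega

/-- The skip-a-dimer bridge is injective on `[0, n]`. [cite: MadrasSlade1993, §1.1] -/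
theorem skipW_inj {n j i i' : ℕ} (hi : i ≤ n) (hi' : i' ≤ n)
    (h0 : skipW n j i 0 = skipW n j i' 0) (h1 : skipW n j i 1 = skipW n j i' 1) : i = i' := by
  simp only [skipW, min_eq_left hi, min_eq_left hi', sX] at h0 h1
  split_ifs at h0 h1 <;> simp only [zz_X, zz_Y, pt_apply_zero, pt_apply_one] at h0 h1 <;> push_cast at h0 h1 <;> omega

/-- Steps of the wide-connector bridge. [cite: EntingJensen2009, §7.4.2, Fig. 7.10] -/
theorem wideW_adj {n j i : ℕ} (hi : i < n) : brickWallGraph.Adj (wideW n j i) (wideW n j (i + 1)) := by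
  rw [brickWallGraph_adj_coord]
  simp only [wideW, min_eq_left hi.le, min_eq_left (by omega : i + 1 ≤ n), wX]
  split_ifs <;> simp only [zz_X, zz_Y, pt_apply_zero, pt_apply_one] <;> push_cast <;> omega

/-- The wide-connector bridge is injective on `[0, n]`. [cite: MadrasSlade1993, §1.1] -/
theorem wideW_inj {n j i i' : ℕ} (hi : i ≤ n) (hi' : i' ≤ n)
    (h0 : wideW n j i 0 = wideW n j i' 0) (h1 : wideW n j i 1 = wideW n j i' 1) : i = i' := by
  simp only [wideW, min_eq_left hi, min_eq_left hi', wX] at h0 h1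
  split_ifs at h0 h1 <;> simp only [zz_X, zz_Y, pt_apply_zero, pt_apply_one] at h0 h1 <;> push_cast at h0 h1 <;> omega

/-! ### §3  The three families are wall bridges of length `4k+1`; their visit counts -/

/-- A coordinate criterion for `wb n` membership. [cite: Beaton2014RotatedHoneycomb, §3.1 (arXiv v3 p. 12: unfolded walks); HammersleyTorrieWhittington1982, §2 (as summarised by Beaton 2014 arXiv v3 p. 11; locator provisional)] -/
theorem mem_wb_of_coords {ω : ℕ → Site 2} (h0 : ω 0 0 = 0 ∧ ω 0 1 = 0) (hfr : ∀ i, n ≤ i → ω i = ω n)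
    (hadj : ∀ i < n, brickWallGraph.Adj (ω i) (ω (i + 1)))
    (hinj : ∀ i i', i ≤ n → i' ≤ n → ω i 0 = ω i' 0 → ω i 1 = ω i' 1 → i = i')
    (hH : ∀ i ≤ n, 0 ≤ ω i 0) (hend : ω n 0 = 0) (htop : 0 < ω n 1)
    (hwin : ∀ i, 1 ≤ i → i < n → 0 < ω i 1 ∧ ω i 1 < ω n 1) : ω ∈ wb n := by
  rw [mem_wb, mem_arches, mem_hp, mem_saws_iff]
  refine ⟨⟨⟨⟨(site_two_eq_iff _ _).2 (by simpa using h0), hfr, hadj, fun i hi i' hi' h => ?_⟩, hH⟩, hend⟩, htop, hwin⟩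
  simp only [Set.mem_setOf_eq] at hi hi'
  exact hinj i i' hi hi' (congrFun h 0) (congrFun h 1)

/-- **The skip-a-dimer bridge is a wall bridge of length `4k+1`** (`j + 2 ≤ k`; end `(0, 2k+1)`). [cite: Beaton2014RotatedHoneycomb, §3.1, proof of Proposition 7 (arXiv v3 p. 12)] -/
theorem skipW_mem_wb {k j : ℕ} (hj : j + 2 ≤ k) : skipW (4 * k + 1) j ∈ wb (4 * k + 1) := by
  refine mem_wb_of_coords ?_ (fun i hi => ?_) (fun i hi => skipW_adj hi) (fun i i' hi hi' h0 h1 => skipW_inj hi hi' h0 h1)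
    (fun i _ => ?_) ?_ ?_ (fun i hi1 hi => ?_)
  · simp only [skipW, Nat.zero_min]; rw [if_pos (Or.inl (by omega)), zz_X, zz_Y]; norm_num
  · simp only [skipW, min_eq_right hi, min_self]
  · simp only [skipW, sX]; split_ifs <;> simp only [zz_X, pt_apply_zero] <;> positivity
  · simp only [skipW, min_self, sX]; split_ifs <;> simp only [zz_X, pt_apply_zero] <;> push_cast <;> omega
  · simp only [skipW, min_self, sX]; split_ifs <;> simp only [zz_Y, pt_apply_one] <;> push_cast <;> omega
  · simp only [skipW, min_self, min_eq_left hi.le, sX]; split_ifs <;> simp only [zz_Y, pt_apply_one] <;> push_cast <;> omega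

/-- **The wide-connector bridge is a wall bridge of length `4k+1`** (`j + 2 ≤ k`; end `(0, 2k−1)`). [cite: Beaton2014RotatedHoneycomb, §3.1, proof of Proposition 7 (arXiv v3 p. 12)] -/
theorem wideW_mem_wb {k j : ℕ} (hj : j + 2 ≤ k) : wideW (4 * k + 1) j ∈ wb (4 * k + 1) := by
  refine mem_wb_of_coords ?_ (fun i hi => ?_) (fun i hi => wideW_adj hi) (fun i i' hi hi' h0 h1 => wideW_inj hi hi' h0 h1)
    (fun i _ => ?_) ?_ ?_ (fun i hi1 hi => ?_)
  · simp only [wideW, Nat.zero_min]; rw [if_pos (by omega), zz_X, zz_Y]; norm_num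
  · simp only [wideW, min_eq_right hi, min_self]
  · simp only [wideW, wX]; split_ifs <;> simp only [zz_X, pt_apply_zero] <;> positivity
  · simp only [wideW, min_self, wX]; split_ifs <;> simp only [zz_X, pt_apply_zero] <;> push_cast <;> omega
  · simp only [wideW, min_self, wX]; split_ifs <;> simp only [zz_Y, pt_apply_one] <;> push_cast <;> omega
  · simp only [wideW, min_self, min_eq_left hi.le, wX]; split_ifs <;> simp only [zz_Y, pt_apply_one] <;> push_cast <;> omega

/-- `visits (4k+1)` of the zig-zag bridge `Arm.zzWalk (4k+1)` is `2k+2`. [cite: Beaton2014RotatedHoneycomb, §3.1 (arXiv v3 p. 11)] -/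
theorem visits_zzWalk (k : ℕ) : visits (4 * k + 1) (zzWalk (4 * k + 1)) = 2 * k + 2 := by
  rw [visits_congr (ξ := zz) (fun i hi => by simp only [zzWalk, min_eq_left hi]), visits_zz]; omega

/-- The skip-a-dimer bridge has `2j+3` visits by time `4j+8` (one more than at the launch). [cite: Beaton2014RotatedHoneycomb, §3.1 (arXiv v3 p. 11)] -/
theorem visits_skipW_mid {n j : ℕ} (hn : 4 * j + 8 ≤ n) : visits (4 * j + 8) (skipW n j) = 2 * j + 3 := by
  have h1 : visits (4 * j + 1) (skipW n j) = 2 * j + 2 := by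
    rw [visits_congr (ξ := zz) (fun i hi => by simp only [skipW, min_eq_left (show i ≤ n by omega), if_pos (Or.inl hi)]), visits_zz]
    omega
  have h2 : visits (4 * j + 1 + 6) (skipW n j) = visits (4 * j + 1) (skipW n j) := by
    refine visits_add_eq_left fun d hd1 hd6 => ?_
    simp only [skipW, min_eq_left (show 4 * j + 1 + d ≤ n by omega), sX]
    split_ifs <;> simp only [zz_X, pt_apply_zero] <;> push_cast <;> omega
  rw [show 4 * j + 8 = 4 * j + 1 + 6 + 1 by omega, visits_succ, h2, h1, if_pos]
  simp only [skipW, min_eq_left (show 4 * j + 1 + 6 + 1 ≤ n by omega), sX]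
  split_ifs <;> simp only [zz_X, pt_apply_zero] <;> push_cast <;> omega

/-- The wide-connector bridge has `2j+3` visits by time `4j+8`. [cite: Beaton2014RotatedHoneycomb, §3.1 (arXiv v3 p. 11)] -/
theorem visits_wideW_mid {n j : ℕ} (hn : 4 * j + 8 ≤ n) : visits (4 * j + 8) (wideW n j) = 2 * j + 3 := by
  have h1 : visits (4 * j + 1) (wideW n j) = 2 * j + 2 := by
    rw [visits_congr (ξ := zz) (fun i hi => by simp only [wideW, min_eq_left (show i ≤ n by omega), if_pos hi]), visits_zz]
    omega
  have h2 : visits (4 * j + 1 + 6) (wideW n j) = visits (4 * j + 1) (wideW n j) := by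
    refine visits_add_eq_left fun d hd1 hd6 => ?_
    simp only [wideW, min_eq_left (show 4 * j + 1 + d ≤ n by omega), wX]
    split_ifs <;> simp only [zz_X, pt_apply_zero] <;> push_cast <;> omega
  rw [show 4 * j + 8 = 4 * j + 1 + 6 + 1 by omega, visits_succ, h2, h1, if_pos]
  simp only [wideW, min_eq_left (show 4 * j + 1 + 6 + 1 ≤ n by omega), wX]
  split_ifs <;> simp only [zz_X, pt_apply_zero] <;> push_cast <;> omega

/-- **The skip-a-dimer bridge has `2k` visits** (two fewer than the zig-zag: the skipped dimer). [cite: Beaton2014RotatedHoneycomb, §3.1 (arXiv v3 p. 11)] -/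
theorem visits_skipW {k j : ℕ} (hj : j + 2 ≤ k) : visits (4 * k + 1) (skipW (4 * k + 1) j) = 2 * k := by
  obtain ⟨b, hb⟩ : ∃ b, 4 * k + 1 = 4 * j + 8 + b := ⟨4 * k + 1 - (4 * j + 8), by omega⟩
  have hmid := visits_skipW_mid (n := 4 * k + 1) (j := j) (by omega)
  -- suffix read on the zig-zag itself
  have hA := visits_add (a := 4 * j + 8) (b := b) (ζ := skipW (4 * k + 1) j) (ξ := fun t => zz (4 * j + 8 + t)) (fun t ht1 htb => by
    simp only [skipW, min_eq_left (show 4 * j + 8 + t ≤ 4 * k + 1 by omega)]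
    rw [if_pos (Or.inr (by omega))])
  have hB := visits_add (a := 4 * j + 8) (b := b) (ζ := zz) (ξ := fun t => zz (4 * j + 8 + t)) (fun t _ _ => rfl)
  have hz0 : (fun t => zz (4 * j + 8 + t)) 0 0 = 0 := (zz_wall_iff _).2 (by omega)
  rw [if_pos hz0] at hA hB
  rw [← hb] at hA hB
  have e1 := visits_zz (4 * k + 1)
  have e2 := visits_zz (4 * j + 8)
  omega

/-- **The wide-connector bridge has `2k` visits** (four extra steps off the wall). [cite: Beaton2014RotatedHoneycomb, §3.1 (arXiv v3 p. 11)] -/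
theorem visits_wideW {k j : ℕ} (hj : j + 2 ≤ k) : visits (4 * k + 1) (wideW (4 * k + 1) j) = 2 * k := by
  obtain ⟨b, hb⟩ : ∃ b, 4 * k + 1 = 4 * j + 8 + b := ⟨4 * k + 1 - (4 * j + 8), by omega⟩
  have hmid := visits_wideW_mid (n := 4 * k + 1) (j := j) (by omega)
  have hA := visits_add (a := 4 * j + 8) (b := b) (ζ := wideW (4 * k + 1) j) (ξ := fun t => zz (4 * j + 4 + t)) (fun t ht1 htb => by
    simp only [wideW, min_eq_left (show 4 * j + 8 + t ≤ 4 * k + 1 by omega)]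
    rw [if_neg (by omega), if_neg (by omega), show 4 * j + 8 + t - 4 = 4 * j + 4 + t by omega])
  have hB := visits_add (a := 4 * j + 4) (b := b) (ζ := zz) (ξ := fun t => zz (4 * j + 4 + t)) (fun t _ _ => rfl)
  have hz0 : (fun t => zz (4 * j + 4 + t)) 0 0 = 0 := (zz_wall_iff _).2 (by omega)
  rw [if_pos hz0] at hA hB
  rw [← hb] at hA
  have e1 := visits_zz (4 * j + 4 + b)
  have e2 := visits_zz (4 * j + 4)
  omega

/-! ### §4  `B^w_{4k+1}(y) ≥ y^{2k+2} + 2(k−1) y^{2k}` -/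

/-- The skip bridges are pairwise distinct (they differ at time `4j+4`). [cite: Beaton2014RotatedHoneycomb, §3.1 (arXiv v3 p. 12)] -/
theorem skipW_ne_skipW {n j j' : ℕ} (hjj : j < j') (hn : 4 * j' + 1 ≤ n) : skipW n j ≠ skipW n j' := by
  intro h
  have := congrFun (congrFun h (4 * j + 4)) 0
  simp only [skipW, min_eq_left (show 4 * j + 4 ≤ n by omega), sX] at this
  split_ifs at this <;> simp only [zz_X, pt_apply_zero] at this <;> push_cast at this <;> omega

/-- The wide bridges are pairwise distinct (they differ at time `4j+3`). [cite: Beaton2014RotatedHoneycomb, §3.1 (arXiv v3 p. 12)] -/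
theorem wideW_ne_wideW {n j j' : ℕ} (hjj : j < j') (hn : 4 * j' + 1 ≤ n) : wideW n j ≠ wideW n j' := by
  intro h
  have := congrFun (congrFun h (4 * j + 3)) 0
  simp only [wideW, min_eq_left (show 4 * j + 3 ≤ n by omega), wX] at this
  split_ifs at this <;> simp only [zz_X, pt_apply_zero] at this <;> push_cast at this <;> omega

/-- A skip bridge is not a wide bridge (end heights `2k+1 ≠ 2k−1`). [cite: Beaton2014RotatedHoneycomb, §3.1 (arXiv v3 p. 12)] -/
theorem skipW_ne_wideW {k j j' : ℕ} (hj : j + 2 ≤ k) (hj' : j' + 2 ≤ k) : skipW (4 * k + 1) j ≠ wideW (4 * k + 1) j' := by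
  intro h
  have := congrFun (congrFun h (4 * k + 1)) 1
  simp only [skipW, wideW, min_self, sX, wX] at this
  split_ifs at this <;> simp only [zz_Y, pt_apply_one] at this <;> push_cast at this <;> omega

/-- The zig-zag is not a skip bridge. [cite: Beaton2014RotatedHoneycomb, §3.1 (arXiv v3 p. 12)] -/
theorem zzWalk_ne_skipW {k j : ℕ} (hj : j + 2 ≤ k) : zzWalk (4 * k + 1) ≠ skipW (4 * k + 1) j := by
  intro h
  have := congrFun (congrFun h (4 * j + 4)) 0
  simp only [zzWalk, skipW, min_eq_left (show 4 * j + 4 ≤ 4 * k + 1 by omega), sX] at this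
  split_ifs at this <;> simp only [zz_X, pt_apply_zero] at this <;> push_cast at this <;> omega

/-- The zig-zag is not a wide bridge. [cite: Beaton2014RotatedHoneycomb, §3.1 (arXiv v3 p. 12)] -/
theorem zzWalk_ne_wideW {k j : ℕ} (hj : j + 2 ≤ k) : zzWalk (4 * k + 1) ≠ wideW (4 * k + 1) j := by
  intro h
  have := congrFun (congrFun h (4 * k + 1)) 1
  simp only [zzWalk, wideW, min_self, wX] at this
  split_ifs at this <;> simp only [zz_Y, pt_apply_one] at this <;> push_cast at this <;> omega

set_option maxHeartbeats 400000 in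
open Classical in
/-- ★★ **`y^{2k+2} + 2(k−1)·y^{2k} ≤ B^w_{4k+1}(y)`** (`y ≥ 0`, `k ≥ 1`): the zig-zag and the `2(k−1)` one-defect bridges (a skip-a-dimer
or a wide connector at any of the `k−1` admissible dimers) are distinct wall bridges of length `4k+1` with `2k+2` resp. `2k` wall visits.
[cite: Beaton2014RotatedHoneycomb, §3.1 (arXiv v3 p. 12: unfolded walks); MadrasSlade1993, §1.2, (1.2.17)] -/
theorem WB_ge_defect (hy : 0 ≤ y) {k : ℕ} (hk : 1 ≤ k) :
    y ^ (2 * k + 2) + 2 * ((k : ℝ) - 1) * y ^ (2 * k) ≤ WB (4 * k + 1) y := by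
  set N := 4 * k + 1 with hN
  set S₁ : Finset (ℕ → Site 2) := (range (k - 1)).image (skipW N) with hS₁
  set S₂ : Finset (ℕ → Site 2) := (range (k - 1)).image (wideW N) with hS₂
  have hinj₁ : Set.InjOn (skipW N) ↑(range (k - 1)) := by
    intro j hj j' hj' h
    rw [Finset.mem_coe, Finset.mem_range] at hj hj'
    by_contra hne
    rcases Nat.lt_or_gt_of_ne hne with hlt | hlt
    · exact skipW_ne_skipW hlt (by omega) h
    · exact skipW_ne_skipW hlt (by omega) h.symm
  have hinj₂ : Set.InjOn (wideW N) ↑(range (k - 1)) := by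
    intro j hj j' hj' h
    rw [Finset.mem_coe, Finset.mem_range] at hj hj'
    by_contra hne
    rcases Nat.lt_or_gt_of_ne hne with hlt | hlt
    · exact wideW_ne_wideW hlt (by omega) h
    · exact wideW_ne_wideW hlt (by omega) h.symm
  have hdisj : Disjoint S₁ S₂ := by
    rw [Finset.disjoint_left]
    intro ω h1 h2
    obtain ⟨j, hj, rfl⟩ := Finset.mem_image.1 h1
    obtain ⟨j', hj', h⟩ := Finset.mem_image.1 h2
    rw [Finset.mem_range] at hj hj'
    exact skipW_ne_wideW (k := k) (by omega) (by omega) h.symm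
  have hbase : zzWalk N ∉ S₁ ∪ S₂ := by
    intro h
    rcases Finset.mem_union.1 h with h | h
    · obtain ⟨j, hj, h⟩ := Finset.mem_image.1 h
      exact zzWalk_ne_skipW (k := k) (by rw [Finset.mem_range] at hj; omega) h.symm
    · obtain ⟨j, hj, h⟩ := Finset.mem_image.1 h
      exact zzWalk_ne_wideW (k := k) (by rw [Finset.mem_range] at hj; omega) h.symm
  have hsub : insert (zzWalk N) (S₁ ∪ S₂) ⊆ wb N := by
    intro ω hω
    rcases Finset.mem_insert.1 hω with rfl | hω
    · exact zzWalk_mem_wb k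
    rcases Finset.mem_union.1 hω with h | h
    · obtain ⟨j, hj, rfl⟩ := Finset.mem_image.1 h
      exact skipW_mem_wb (by rw [Finset.mem_range] at hj; omega)
    · obtain ⟨j, hj, rfl⟩ := Finset.mem_image.1 h
      exact wideW_mem_wb (by rw [Finset.mem_range] at hj; omega)
  have hv₁ : ∀ j ∈ range (k - 1), y ^ visits N (skipW N j) = y ^ (2 * k) := fun j hj => by
    rw [Finset.mem_range] at hj
    rw [hN, visits_skipW (k := k) (j := j) (by omega)]
  have hv₂ : ∀ j ∈ range (k - 1), y ^ visits N (wideW N j) = y ^ (2 * k) := fun j hj => by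
    rw [Finset.mem_range] at hj
    rw [hN, visits_wideW (k := k) (j := j) (by omega)]
  have hcard : ((range (k - 1)).card : ℝ) = (k : ℝ) - 1 := by rw [Finset.card_range, Nat.cast_sub hk]; push_cast; ring
  have hsum₁ : ∑ ω ∈ S₁, y ^ visits N ω = ((k : ℝ) - 1) * y ^ (2 * k) := by
    rw [hS₁, Finset.sum_image hinj₁, Finset.sum_congr rfl hv₁, Finset.sum_const, nsmul_eq_mul, hcard]
  have hsum₂ : ∑ ω ∈ S₂, y ^ visits N ω = ((k : ℝ) - 1) * y ^ (2 * k) := by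
    rw [hS₂, Finset.sum_image hinj₂, Finset.sum_congr rfl hv₂, Finset.sum_const, nsmul_eq_mul, hcard]
  calc y ^ (2 * k + 2) + 2 * ((k : ℝ) - 1) * y ^ (2 * k)
      = y ^ visits N (zzWalk N) + (∑ ω ∈ S₁, y ^ visits N ω + ∑ ω ∈ S₂, y ^ visits N ω) := by
        rw [hsum₁, hsum₂, hN, visits_zzWalk]; ring
    _ = ∑ ω ∈ insert (zzWalk N) (S₁ ∪ S₂), y ^ visits N ω := by
        rw [Finset.sum_insert hbase, Finset.sum_union hdisj]
    _ ≤ WB N y := Finset.sum_le_sum_of_subset_of_nonneg hsub fun _ _ _ => pow_nonneg hy _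

end Defect

/-! ### §5  From `B^w_{4k+1} ≥ y^{2k}(y² + 2(k−1))` to `y (β_rot(y)² − y) ≥ 1 − 2/m − (2m+1)/y²` -/

/-- **`y^{2k}(y² + 2(k−1)) ≤ (β_rot(y)⁴)^{k+1}`** (`y > 0`, `k ≥ 1`): `B^w_{4k+1} = w_{k+1} ≤ (β_rot⁴)^{k+1}` (supermultiplicativity).
[cite: Beaton2014RotatedHoneycomb, §3.1 (arXiv v3 p. 12); MadrasSlade1993, §1.2, (1.2.17) (p. 11: `b_n ≤ μ^n`)] -/
theorem pow_mul_le_armRate_pow (hy : 0 < y) {k : ℕ} (hk : 1 ≤ k) :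
    y ^ (2 * k) * (y ^ 2 + 2 * ((k : ℝ) - 1)) ≤ (armRate y ^ 4) ^ (k + 1) := by
  have h := wseq_le_pow hy (k + 1)
  rw [wseq, if_neg (by omega), show 4 * (k + 1) - 3 = 4 * k + 1 by omega] at h
  have h2 := Defect.WB_ge_defect hy.le hk
  calc y ^ (2 * k) * (y ^ 2 + 2 * ((k : ℝ) - 1)) = y ^ (2 * k + 2) + 2 * ((k : ℝ) - 1) * y ^ (2 * k) := by ring
    _ ≤ _ := h2.trans h

/-- **Root extraction**: if `B ≥ 0`, `Y > 0`, `m ≥ 1`, `0 ≤ x ≤ 1` and `B^m ≥ Y^m (1 + x)`, then `B ≥ Y (1 + (x − x²)/m)` — because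
`(1 + (x−x²)/m)^m ≤ exp(x − x²) ≤ 1 + (x − x²) + (x − x²)² ≤ 1 + x`. [cite: MadrasSlade1993, §1.2, Lemma 1.2.2, (1.2.17)] -/
theorem root_extraction {B Y x : ℝ} {m : ℕ} (hB : 0 ≤ B) (hY : 0 < Y) (hm : 1 ≤ m) (hx0 : 0 ≤ x) (hx1 : x ≤ 1)
    (h : Y ^ m * (1 + x) ≤ B ^ m) : Y * (1 + (x - x ^ 2) / m) ≤ B := by
  have hm0 : (0 : ℝ) < m := by exact_mod_cast hm
  set t : ℝ := (x - x ^ 2) / m with ht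
  have hxx : 0 ≤ x - x ^ 2 := by nlinarith
  have ht0 : 0 ≤ t := div_nonneg hxx hm0.le
  by_contra hlt
  push Not at hlt
  have h1 : B ^ m < (Y * (1 + t)) ^ m := pow_lt_pow_left₀ hlt hB (by omega)
  have h2 : (1 + t) ^ m ≤ Real.exp (x - x ^ 2) := by
    have e : Real.exp (x - x ^ 2) = Real.exp t ^ m := by
      rw [← Real.exp_nat_mul, ht]; congr 1; field_simp
    rw [e]
    exact pow_le_pow_left₀ (by linarith) (by linarith [Real.add_one_le_exp t]) m
  have h3 : Real.exp (x - x ^ 2) ≤ 1 + x := by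
    -- `e^u ≤ 1 + u + u²` on `[0, 1]` (Taylor remainder `|e^u − 1 − u| ≤ u²` for `|u| ≤ 1`), at `u = x − x²`
    have hu1 : x - x ^ 2 ≤ 1 := by nlinarith
    have hexp := Real.abs_exp_sub_one_sub_id_le (x := x - x ^ 2) (by rw [abs_of_nonneg hxx]; exact hu1)
    have hexp' := (abs_le.1 hexp).2
    nlinarith [sq_nonneg x, mul_nonneg hx0 hxx]
  have h4 : (Y * (1 + t)) ^ m ≤ Y ^ m * (1 + x) := by
    rw [mul_pow]; exact mul_le_mul_of_nonneg_left (h2.trans h3) (by positivity)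
  linarith

/-- **`β_rot(y)⁴ ≥ y² + 2(m−2)/m − 4(m−2)²/(m y²)`** for `y > 0`, `m ≥ 2`, `y² ≥ 2(m−2)` (root extraction from the defect bound with
`k = m − 1`). [cite: Beaton2014RotatedHoneycomb, §3.1 (arXiv v3 p. 12); MadrasSlade1993, §1.2, Lemma 1.2.2] -/
theorem armRate_pow_four_ge (hy : 0 < y) {m : ℕ} (hm : 2 ≤ m) (hbig : 2 * ((m : ℝ) - 2) ≤ y ^ 2) :
    y ^ 2 + (2 * ((m : ℝ) - 2) / m - 4 * ((m : ℝ) - 2) ^ 2 / (m * y ^ 2)) ≤ armRate y ^ 4 := by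
  obtain ⟨k, rfl⟩ : ∃ k, m = k + 1 := ⟨m - 1, by omega⟩
  have hk : 1 ≤ k := by omega
  have hY0 : 0 < y ^ 2 := by positivity
  have hm0 : (0 : ℝ) < ((k + 1 : ℕ) : ℝ) := by positivity
  obtain ⟨x, hx⟩ : ∃ x : ℝ, x = 2 * (((k + 1 : ℕ) : ℝ) - 2) / y ^ 2 := ⟨_, rfl⟩
  have hx0 : 0 ≤ x := by rw [hx]; exact div_nonneg (by push_cast; linarith [show (1 : ℝ) ≤ k from by exact_mod_cast hk]) hY0.le
  have hx1 : x ≤ 1 := by rw [hx, div_le_one hY0]; linarith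
  have hYx : y ^ 2 * x = 2 * (((k + 1 : ℕ) : ℝ) - 2) := by rw [hx]; field_simp
  have hin := pow_mul_le_armRate_pow hy hk
  have hin' : (y ^ 2) ^ (k + 1) * (1 + x) ≤ (armRate y ^ 4) ^ (k + 1) := by
    have e : (y ^ 2) ^ (k + 1) * (1 + x) = y ^ (2 * k) * (y ^ 2 + 2 * ((k : ℝ) - 1)) := by
      have e1 : (y ^ 2) ^ (k + 1) = y ^ (2 * k) * y ^ 2 := by rw [pow_succ, ← pow_mul]
      have e2 : y ^ 2 * (1 + x) = y ^ 2 + 2 * ((k : ℝ) - 1) := by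
        rw [mul_add, mul_one, hYx]; push_cast; ring
      rw [e1, mul_assoc, e2]
    rw [e]; exact hin
  have hroot := root_extraction (by positivity) hY0 (by omega) hx0 hx1 hin'
  have e3 : y ^ 2 * (1 + (x - x ^ 2) / ((k + 1 : ℕ) : ℝ)) =
      y ^ 2 + (2 * (((k + 1 : ℕ) : ℝ) - 2) / ((k + 1 : ℕ) : ℝ) - 4 * (((k + 1 : ℕ) : ℝ) - 2) ^ 2 / (((k + 1 : ℕ) : ℝ) * y ^ 2)) := by
    rw [hx]; field_simp; ring
  rw [e3] at hroot
  exact hroot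

/-- From `y² + a ≤ b²` (`0 ≤ a ≤ 4y²`, `b ≥ 0`) to `y + a/(2y) − a²/(8y³) ≤ b`. [cite: MadrasSlade1993, §1.2, (1.2.17)] -/
theorem sqrt_lower_aux {a b : ℝ} (hy : 0 < y) (ha0 : 0 ≤ a) (ha8 : a ≤ 4 * y ^ 2) (hb : 0 ≤ b) (h : y ^ 2 + a ≤ b ^ 2) :
    y + a / (2 * y) - a ^ 2 / (8 * y ^ 3) ≤ b := by
  have hr0 : 0 ≤ y + a / (2 * y) - a ^ 2 / (8 * y ^ 3) := by
    have : a ^ 2 / (8 * y ^ 3) ≤ a / (2 * y) := by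
      rw [div_le_div_iff₀ (by positivity) (by positivity)]
      nlinarith [pow_pos hy 3, mul_nonneg ha0 (sub_nonneg.2 ha8)]
    linarith [div_nonneg ha0 (by positivity : (0 : ℝ) ≤ 2 * y)]
  have hsq : (y + a / (2 * y) - a ^ 2 / (8 * y ^ 3)) ^ 2 ≤ y ^ 2 + a := by
    have e : (y + a / (2 * y) - a ^ 2 / (8 * y ^ 3)) ^ 2 = y ^ 2 + a - a ^ 3 / (8 * y ^ 4) + a ^ 4 / (64 * y ^ 6) := by
      field_simp; ring
    rw [e]
    have h1 : a ^ 4 / (64 * y ^ 6) ≤ a ^ 3 / (8 * y ^ 4) := by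
      rw [div_le_div_iff₀ (by positivity) (by positivity)]
      nlinarith [pow_pos hy 4, pow_pos hy 6, pow_nonneg ha0 3, mul_nonneg (pow_nonneg ha0 3) (sub_nonneg.2 ha8)]
    linarith
  exact (pow_le_pow_iff_left₀ hr0 hb two_ne_zero).1 (hsq.trans h)

set_option maxHeartbeats 400000 in
/-- ★★★ **Second-order LOWER bound for the armchair wall-bridge rate**: for every `y ≥ 1` and every integer `m ≥ 2`,
`1 − 2/m − (2m+1)/y² ≤ y · (β_rot(y)² − y)`.  (From `B^w_{4(m−1)+1}` with its `2(m−2)` one-defect bridges: `β_rot⁴ ≥ y² + 2(m−2)/m − 4(m−2)²/(m y²)`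
for `y² ≥ 2(m−2)`; the range `y² < 2(m−2)` is covered by `β_rot² > y`.)  Hence `liminf_{y→∞} y (β_rot(y)² − y) ≥ 1`.
[cite: Beaton2014RotatedHoneycomb, §3.1 (arXiv v3 p. 12), Proposition 7 (p. 11: "μ(y) ≥ max{μ, √y}"); MadrasSlade1993, §1.2, Lemma 1.2.2, (1.2.17)] -/
theorem mul_armRate_sq_sub_ge (hy : 1 ≤ y) {m : ℕ} (hm : 2 ≤ m) :
    1 - 2 / (m : ℝ) - (2 * m + 1) / y ^ 2 ≤ y * (armRate y ^ 2 - y) := by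
  have hy0 : 0 < y := by linarith
  have hm0 : (0 : ℝ) < m := by exact_mod_cast (show 0 < m by omega)
  have hm2 : (2 : ℝ) ≤ m := by exact_mod_cast hm
  have hβ0 : 0 < armRate y := armRate_pos y
  have hY0 : 0 < y ^ 2 := by positivity
  -- the trivial range
  have hpos : 0 < y * (armRate y ^ 2 - y) := by
    have h1 := sqrt_lt_armRate hy0
    have h3 := pow_lt_pow_left₀ h1 (Real.sqrt_nonneg _) two_ne_zero
    rw [Real.sq_sqrt hy0.le] at h3
    exact mul_pos hy0 (by linarith)
  rcases lt_or_ge (y ^ 2) (2 * ((m : ℝ) - 2)) with hsmall | hbig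
  · have h1 : 1 < (2 * (m : ℝ) + 1) / y ^ 2 := by rw [lt_div_iff₀ hY0]; linarith
    have h2 : 0 < 2 / (m : ℝ) := by positivity
    linarith
  -- the main range
  have h4 := armRate_pow_four_ge hy0 hm hbig
  obtain ⟨a, ha⟩ : ∃ a : ℝ, a = 2 * ((m : ℝ) - 2) / m - 4 * ((m : ℝ) - 2) ^ 2 / (m * y ^ 2) := ⟨_, rfl⟩
  rw [← ha] at h4
  have ha_le : a ≤ 2 * ((m : ℝ) - 2) / m := by
    rw [ha]; linarith [div_nonneg (by positivity : (0 : ℝ) ≤ 4 * ((m : ℝ) - 2) ^ 2) (by positivity : (0 : ℝ) ≤ m * y ^ 2)]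
  have h2m : 2 * ((m : ℝ) - 2) / m ≤ 2 := by rw [div_le_iff₀ hm0]; linarith
  have ha2 : a ≤ 2 := ha_le.trans h2m
  have ha0 : 0 ≤ a := by
    -- `4(m−2)²/(m y²) ≤ 2(m−2)/m` since `y² ≥ 2(m−2)`
    rw [ha, sub_nonneg, div_le_div_iff₀ (by positivity) hm0]
    have hm2' : 0 ≤ (m : ℝ) - 2 := by linarith
    nlinarith [mul_nonneg hm2' hm0.le, mul_le_mul_of_nonneg_left hbig (mul_nonneg hm2' hm0.le)]
  have hβ2 := sqrt_lower_aux hy0 ha0 (by nlinarith) (by positivity : (0 : ℝ) ≤ armRate y ^ 2)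
    (by rw [show (armRate y ^ 2) ^ 2 = armRate y ^ 4 by ring]; exact h4)
  -- `y(β² − y) ≥ a/2 − a²/(8y²) ≥ a/2 − 1/(2y²)` and `a/2 ≥ 1 − 2/m − 2m/y²`
  have hmain : a / 2 - a ^ 2 / (8 * y ^ 2) ≤ y * (armRate y ^ 2 - y) := by
    have e : y * (y + a / (2 * y) - a ^ 2 / (8 * y ^ 3) - y) = a / 2 - a ^ 2 / (8 * y ^ 2) := by field_simp; ring
    rw [← e]; exact mul_le_mul_of_nonneg_left (by linarith) hy0.le
  have h5 : a ^ 2 / (8 * y ^ 2) ≤ 1 / (2 * y ^ 2) := by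
    rw [div_le_div_iff₀ (by positivity) (by positivity)]
    have : a ^ 2 ≤ 4 := by nlinarith
    nlinarith [hY0]
  have h6 : 4 * ((m : ℝ) - 2) ^ 2 / (m * y ^ 2) ≤ 4 * m / y ^ 2 := by
    rw [div_le_div_iff₀ (by positivity) hY0]
    have : ((m : ℝ) - 2) ^ 2 ≤ (m : ℝ) * m := by nlinarith
    nlinarith [hY0]
  have h7 : 2 * ((m : ℝ) - 2) / m = 2 - 4 / m := by field_simp; ring
  have h8 : (2 * (m : ℝ) + 1) / y ^ 2 = 2 * m / y ^ 2 + 1 / y ^ 2 := by field_simp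
  have h9 : 1 / (2 * y ^ 2) ≤ 1 / y ^ 2 := by rw [div_le_div_iff₀ (by positivity) hY0]; nlinarith
  have h10 : a / 2 = 1 - 2 / m - 2 * ((m : ℝ) - 2) ^ 2 / (m * y ^ 2) := by rw [ha, h7]; field_simp; ring
  have h11 : 2 * ((m : ℝ) - 2) ^ 2 / (m * y ^ 2) ≤ 2 * m / y ^ 2 := by
    have := h6; rw [show 4 * ((m : ℝ) - 2) ^ 2 / (m * y ^ 2) = 2 * (2 * ((m : ℝ) - 2) ^ 2 / (m * y ^ 2)) by ring,
      show 4 * (m : ℝ) / y ^ 2 = 2 * (2 * m / y ^ 2) by ring] at this; linarith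
  rw [h8]
  linarith [hmain, h5, h9, h10, h11]

/-- ★★★ **`liminf_{y→∞} y (β_rot(y)² − y) ≥ 1`**: for every `ε > 0`, eventually `1 − ε ≤ y (β_rot(y)² − y)`.
[cite: Beaton2014RotatedHoneycomb, §3.1 (arXiv v3 p. 12)] -/
theorem eventually_mul_armRate_sq_sub_ge {ε : ℝ} (hε : 0 < ε) : ∀ᶠ y : ℝ in atTop, 1 - ε ≤ y * (armRate y ^ 2 - y) := by
  obtain ⟨m, hm⟩ := exists_nat_gt (4 / ε)
  have hm2 : 2 ≤ m + 2 := by omega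
  have hmR : (0 : ℝ) < (m + 2 : ℕ) := by positivity
  have h1 : 2 / ((m + 2 : ℕ) : ℝ) ≤ ε / 2 := by
    rw [div_le_iff₀ hmR]
    have : (4 : ℝ) / ε < m := hm
    rw [div_lt_iff₀ hε] at this
    push_cast; nlinarith
  have h2 : Tendsto (fun y : ℝ => (2 * ((m + 2 : ℕ) : ℝ) + 1) / y ^ 2) atTop (𝓝 0) :=
    tendsto_const_nhds.div_atTop (tendsto_pow_atTop two_ne_zero)
  filter_upwards [eventually_ge_atTop (1 : ℝ), (tendsto_order.1 h2).2 (ε / 2) (by linarith)] with y hy hlt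
  have := mul_armRate_sq_sub_ge hy hm2
  linarith

/-- ★ **The census face at length `13`**: `y⁸ + 4y⁶ ≤ B^w_13(y)` (zig-zag + the four one-defect bridges; the full census is
`y⁸ + 4y⁶ + 8y⁴`). [cite: Beaton2014RotatedHoneycomb, §3.1 (arXiv v3 p. 12)] -/
theorem pow_add_four_mul_pow_le_WB_thirteen (hy : 0 ≤ y) : y ^ 8 + 4 * y ^ 6 ≤ WB 13 y := by
  have h := Defect.WB_ge_defect hy (k := 3) (by norm_num)
  norm_num at h
  linarith

/-! ### §6  The next seed: the two nine-step defects and `B^w_{4k+3}(y) ≥ 2(k−1)·y^{2k}` -/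

namespace Defect

/-- `X`-offsets of the nine-step excursion `A` = `(1,Y)(2,Y)(3,Y)(3,Y+1)(2,Y+1)(2,Y+2)(1,Y+2)(1,Y+3)(0,Y+3)` (`d = 1..9`; `Y`-offset
`0,0,0,1,1,2,2,3,3`). [cite: EntingJensen2009, §7.4.2, Fig. 7.10] -/
def aX (d : ℕ) : ℕ := if d ≤ 3 then d else (10 - d) / 2

/-- `Y`-offsets of the excursion `A`. [cite: EntingJensen2009, §7.4.2, Fig. 7.10] -/
def aY (d : ℕ) : ℕ := if d ≤ 3 then 0 else (d - 2) / 2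

/-- `X`-offsets of the nine-step excursion `B` = `(1,Y)(1,Y+1)(2,Y+1)(2,Y+2)(3,Y+2)(3,Y+3)(2,Y+3)(1,Y+3)(0,Y+3)` (`Y`-offset
`0,1,1,2,2,3,3,3,3`). [cite: EntingJensen2009, §7.4.2, Fig. 7.10] -/
def bX (d : ℕ) : ℕ := if d ≤ 6 then (d + 1) / 2 else 9 - d

/-- `Y`-offsets of the excursion `B`. [cite: EntingJensen2009, §7.4.2, Fig. 7.10] -/
def bY (d : ℕ) : ℕ := if d ≤ 6 then d / 2 else 3

/-- **The nine-step defect bridge of type `A`** (length `n = 4k+3`): zig-zag to the dimer top `(0,2j+1)`, excursion `A` to the dimer bottom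
`(0, 2j+4)` at time `4j+10`, then the zig-zag two steps behind schedule. [cite: Beaton2014RotatedHoneycomb, §3.1 (arXiv v3 p. 12: unfolded walks)] -/
def nineA (n j : ℕ) (i : ℕ) : Site 2 :=
  if min i n ≤ 4 * j + 1 then zz (min i n)
  else if min i n ≤ 4 * j + 9 then pt (aX (min i n - (4 * j + 1)) : ℤ) ((2 * j + 1 + aY (min i n - (4 * j + 1)) : ℕ) : ℤ)
  else zz (min i n - 2)

/-- **The nine-step defect bridge of type `B`**. [cite: Beaton2014RotatedHoneycomb, §3.1 (arXiv v3 p. 12: unfolded walks)] -/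
def nineB (n j : ℕ) (i : ℕ) : Site 2 :=
  if min i n ≤ 4 * j + 1 then zz (min i n)
  else if min i n ≤ 4 * j + 9 then pt (bX (min i n - (4 * j + 1)) : ℤ) ((2 * j + 1 + bY (min i n - (4 * j + 1)) : ℕ) : ℤ)
  else zz (min i n - 2)

set_option maxHeartbeats 400000 in
/-- Steps of `nineA`. [cite: EntingJensen2009, §7.4.2, Fig. 7.10] -/
theorem nineA_adj {n j i : ℕ} (hi : i < n) : brickWallGraph.Adj (nineA n j i) (nineA n j (i + 1)) := by
  rw [brickWallGraph_adj_coord]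
  simp only [nineA, min_eq_left hi.le, min_eq_left (by omega : i + 1 ≤ n)]
  split_ifs <;> simp only [zz_X, zz_Y, pt_apply_zero, pt_apply_one, aX, aY] <;> (try split_ifs) <;> push_cast <;>
    (try simp only [and_true]) <;> omega

/-- `nineA` is injective on `[0, n]`. [cite: MadrasSlade1993, §1.1] -/
theorem nineA_inj {n j i i' : ℕ} (hi : i ≤ n) (hi' : i' ≤ n)
    (h0 : nineA n j i 0 = nineA n j i' 0) (h1 : nineA n j i 1 = nineA n j i' 1) : i = i' := by
  simp only [nineA, min_eq_left hi, min_eq_left hi', aX, aY] at h0 h1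
  split_ifs at h0 h1 <;> simp only [zz_X, zz_Y, pt_apply_zero, pt_apply_one] at h0 h1 <;> push_cast at h0 h1 <;> omega

set_option maxHeartbeats 400000 in
/-- Steps of `nineB`. [cite: EntingJensen2009, §7.4.2, Fig. 7.10] -/
theorem nineB_adj {n j i : ℕ} (hi : i < n) : brickWallGraph.Adj (nineB n j i) (nineB n j (i + 1)) := by
  rw [brickWallGraph_adj_coord]
  simp only [nineB, min_eq_left hi.le, min_eq_left (by omega : i + 1 ≤ n)]
  split_ifs <;> simp only [zz_X, zz_Y, pt_apply_zero, pt_apply_one, bX, bY] <;> (try split_ifs) <;> push_cast <;>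
    (try simp only [and_true]) <;> omega

/-- `nineB` is injective on `[0, n]`. [cite: MadrasSlade1993, §1.1] -/
theorem nineB_inj {n j i i' : ℕ} (hi : i ≤ n) (hi' : i' ≤ n)
    (h0 : nineB n j i 0 = nineB n j i' 0) (h1 : nineB n j i 1 = nineB n j i' 1) : i = i' := by
  simp only [nineB, min_eq_left hi, min_eq_left hi', bX, bY] at h0 h1
  split_ifs at h0 h1 <;> simp only [zz_X, zz_Y, pt_apply_zero, pt_apply_one] at h0 h1 <;> push_cast at h0 h1 <;> omega

/-- **`nineA` is a wall bridge of length `4k+3`** (`j + 2 ≤ k`; end `(0, 2k+1)`). [cite: Beaton2014RotatedHoneycomb, §3.1 (arXiv v3 p. 12)] -/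
theorem nineA_mem_wb {k j : ℕ} (hj : j + 2 ≤ k) : nineA (4 * k + 3) j ∈ wb (4 * k + 3) := by
  refine mem_wb_of_coords ?_ (fun i hi => ?_) (fun i hi => nineA_adj hi) (fun i i' hi hi' h0 h1 => nineA_inj hi hi' h0 h1)
    (fun i _ => ?_) ?_ ?_ (fun i hi1 hi => ?_)
  · simp only [nineA, Nat.zero_min]; rw [if_pos (by omega), zz_X, zz_Y]; norm_num
  · simp only [nineA, min_eq_right hi, min_self]
  · simp only [nineA, aX, aY]; split_ifs <;> simp only [zz_X, pt_apply_zero] <;> positivity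
  · simp only [nineA, min_self, aX, aY]; split_ifs <;> simp only [zz_X, pt_apply_zero] <;> push_cast <;> omega
  · simp only [nineA, min_self, aX, aY]; split_ifs <;> simp only [zz_Y, pt_apply_one] <;> push_cast <;> omega
  · simp only [nineA, min_self, min_eq_left hi.le, aX, aY]; split_ifs <;> simp only [zz_Y, pt_apply_one] <;> push_cast <;> omega

/-- **`nineB` is a wall bridge of length `4k+3`** (`j + 2 ≤ k`). [cite: Beaton2014RotatedHoneycomb, §3.1 (arXiv v3 p. 12)] -/
theorem nineB_mem_wb {k j : ℕ} (hj : j + 2 ≤ k) : nineB (4 * k + 3) j ∈ wb (4 * k + 3) := by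
  refine mem_wb_of_coords ?_ (fun i hi => ?_) (fun i hi => nineB_adj hi) (fun i i' hi hi' h0 h1 => nineB_inj hi hi' h0 h1)
    (fun i _ => ?_) ?_ ?_ (fun i hi1 hi => ?_)
  · simp only [nineB, Nat.zero_min]; rw [if_pos (by omega), zz_X, zz_Y]; norm_num
  · simp only [nineB, min_eq_right hi, min_self]
  · simp only [nineB, bX, bY]; split_ifs <;> simp only [zz_X, pt_apply_zero] <;> positivity
  · simp only [nineB, min_self, bX, bY]; split_ifs <;> simp only [zz_X, pt_apply_zero] <;> push_cast <;> omega
  · simp only [nineB, min_self, bX, bY]; split_ifs <;> simp only [zz_Y, pt_apply_one] <;> push_cast <;> omega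
  · simp only [nineB, min_self, min_eq_left hi.le, bX, bY]; split_ifs <;> simp only [zz_Y, pt_apply_one] <;> push_cast <;> omega

/-- Both nine-step defect bridges have `2j+3` visits by time `4j+10`. [cite: Beaton2014RotatedHoneycomb, §3.1 (arXiv v3 p. 11)] -/
theorem visits_nine_mid {n j : ℕ} (hn : 4 * j + 10 ≤ n) :
    visits (4 * j + 10) (nineA n j) = 2 * j + 3 ∧ visits (4 * j + 10) (nineB n j) = 2 * j + 3 := by
  have hA1 : visits (4 * j + 1) (nineA n j) = 2 * j + 2 := by
    rw [visits_congr (ξ := zz) (fun i hi => by simp only [nineA, min_eq_left (show i ≤ n by omega), if_pos hi]), visits_zz]; omega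
  have hB1 : visits (4 * j + 1) (nineB n j) = 2 * j + 2 := by
    rw [visits_congr (ξ := zz) (fun i hi => by simp only [nineB, min_eq_left (show i ≤ n by omega), if_pos hi]), visits_zz]; omega
  have hA2 : visits (4 * j + 1 + 8) (nineA n j) = visits (4 * j + 1) (nineA n j) := by
    refine visits_add_eq_left fun d hd1 hd8 => ?_
    simp only [nineA, min_eq_left (show 4 * j + 1 + d ≤ n by omega), aX, aY]
    split_ifs <;> simp only [zz_X, pt_apply_zero] <;> push_cast <;> omega
  have hB2 : visits (4 * j + 1 + 8) (nineB n j) = visits (4 * j + 1) (nineB n j) := by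
    refine visits_add_eq_left fun d hd1 hd8 => ?_
    simp only [nineB, min_eq_left (show 4 * j + 1 + d ≤ n by omega), bX, bY]
    split_ifs <;> simp only [zz_X, pt_apply_zero] <;> push_cast <;> omega
  constructor
  · rw [show 4 * j + 10 = 4 * j + 1 + 8 + 1 by omega, visits_succ, hA2, hA1, if_pos]
    simp only [nineA, min_eq_left (show 4 * j + 1 + 8 + 1 ≤ n by omega), aX, aY]
    split_ifs <;> simp only [zz_X, pt_apply_zero] <;> push_cast <;> omega
  · rw [show 4 * j + 10 = 4 * j + 1 + 8 + 1 by omega, visits_succ, hB2, hB1, if_pos]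
    simp only [nineB, min_eq_left (show 4 * j + 1 + 8 + 1 ≤ n by omega), bX, bY]
    split_ifs <;> simp only [zz_X, pt_apply_zero] <;> push_cast <;> omega

/-- **The nine-step defect bridges have `2k` visits** at length `4k+3`. [cite: Beaton2014RotatedHoneycomb, §3.1 (arXiv v3 p. 11)] -/
theorem visits_nine {k j : ℕ} (hj : j + 2 ≤ k) :
    visits (4 * k + 3) (nineA (4 * k + 3) j) = 2 * k ∧ visits (4 * k + 3) (nineB (4 * k + 3) j) = 2 * k := by
  obtain ⟨b, hb⟩ : ∃ b, 4 * k + 3 = 4 * j + 10 + b := ⟨4 * k + 3 - (4 * j + 10), by omega⟩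
  obtain ⟨hmA, hmB⟩ := visits_nine_mid (n := 4 * k + 3) (j := j) (by omega)
  have hB := visits_add (a := 4 * j + 8) (b := b) (ζ := zz) (ξ := fun t => zz (4 * j + 8 + t)) (fun t _ _ => rfl)
  have hz0 : (fun t => zz (4 * j + 8 + t)) 0 0 = 0 := (zz_wall_iff _).2 (by omega)
  rw [if_pos hz0] at hB
  have e1 := visits_zz (4 * j + 8 + b)
  have e2 := visits_zz (4 * j + 8)
  constructor
  · have hA := visits_add (a := 4 * j + 10) (b := b) (ζ := nineA (4 * k + 3) j) (ξ := fun t => zz (4 * j + 8 + t)) (fun t ht1 htb => by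
      simp only [nineA, min_eq_left (show 4 * j + 10 + t ≤ 4 * k + 3 by omega)]
      rw [if_neg (by omega), if_neg (by omega), show 4 * j + 10 + t - 2 = 4 * j + 8 + t by omega])
    rw [if_pos hz0, ← hb] at hA
    omega
  · have hA := visits_add (a := 4 * j + 10) (b := b) (ζ := nineB (4 * k + 3) j) (ξ := fun t => zz (4 * j + 8 + t)) (fun t ht1 htb => by
      simp only [nineB, min_eq_left (show 4 * j + 10 + t ≤ 4 * k + 3 by omega)]
      rw [if_neg (by omega), if_neg (by omega), show 4 * j + 10 + t - 2 = 4 * j + 8 + t by omega])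
    rw [if_pos hz0, ← hb] at hA
    omega

/-- At time `4j+4` the type-`A` bridge is at `X = 3`, type `B` at `X = 2`, the zig-zag (and any later defect) at `X = 0`.
[cite: Beaton2014RotatedHoneycomb, §3.1 (arXiv v3 p. 12)] -/
theorem nine_X_at {n j : ℕ} (hn : 4 * j + 4 ≤ n) : nineA n j (4 * j + 4) 0 = 3 ∧ nineB n j (4 * j + 4) 0 = 2 := by
  constructor
  · simp only [nineA, min_eq_left hn, aX, aY]
    split_ifs <;> simp only [zz_X, pt_apply_zero] <;> push_cast <;> omega
  · simp only [nineB, min_eq_left hn, bX, bY]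
    split_ifs <;> simp only [zz_X, pt_apply_zero] <;> push_cast <;> omega

/-- A later-launched nine-defect bridge is on the wall at time `4j+4`. [cite: Beaton2014RotatedHoneycomb, §3.1 (arXiv v3 p. 12)] -/
theorem nine_X_at_of_lt {n j j' : ℕ} (hjj : j < j') (hn : 4 * j + 4 ≤ n) : nineA n j' (4 * j + 4) 0 = 0 ∧ nineB n j' (4 * j + 4) 0 = 0 := by
  constructor
  · simp only [nineA, min_eq_left hn, aX, aY]
    split_ifs <;> simp only [zz_X, pt_apply_zero] <;> push_cast <;> omega
  · simp only [nineB, min_eq_left hn, bX, bY]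
    split_ifs <;> simp only [zz_X, pt_apply_zero] <;> push_cast <;> omega

set_option maxHeartbeats 400000 in
open Classical in
/-- ★★ **`2(k−1)·y^{2k} ≤ B^w_{4k+3}(y)`** (`y ≥ 0`): in the length class `4k+3` — where there is NO zig-zag bridge — the leading configurations
are the zig-zag with ONE nine-step defect (two shapes at any of `k−1` dimers); a-ref-1's census gives EQUALITY of the top coefficient
(`B^w_11 = 2y⁴`, `B^w_15 = 4y⁶ + 14y⁴`, `B^w_19 = 6y⁸ + …`).  This is the seed count `a₉↑ = 2` of the third-order term.
[cite: Beaton2014RotatedHoneycomb, §3.1 (arXiv v3 p. 12: unfolded walks); MadrasSlade1993, §1.2, (1.2.17)] -/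
theorem WB_ge_nine_defect (hy : 0 ≤ y) (k : ℕ) : 2 * ((k : ℝ) - 1) * y ^ (2 * k) ≤ WB (4 * k + 3) y := by
  rcases Nat.lt_or_ge k 1 with hk | hk
  · have : (k : ℝ) = 0 := by exact_mod_cast (show k = 0 by omega)
    rw [this]; linarith [WB_nonneg (4 * k + 3) hy, pow_nonneg hy (2 * k)]
  set N := 4 * k + 3 with hN
  set S₁ : Finset (ℕ → Site 2) := (range (k - 1)).image (nineA N) with hS₁
  set S₂ : Finset (ℕ → Site 2) := (range (k - 1)).image (nineB N) with hS₂
  have hne : ∀ {f g : ℕ → ℕ → Site 2} {j j' : ℕ} (t : ℕ), f j t 0 ≠ g j' t 0 → f j ≠ g j' :=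
    fun t h e => h (by rw [e])
  have hinj₁ : Set.InjOn (nineA N) ↑(range (k - 1)) := by
    intro j hj j' hj' h
    rw [Finset.mem_coe, Finset.mem_range] at hj hj'
    by_contra hjj
    rcases Nat.lt_or_gt_of_ne hjj with hlt | hlt
    · exact hne (4 * j + 4) (by rw [(nine_X_at (n := N) (by omega)).1, (nine_X_at_of_lt hlt (n := N) (by omega)).1]; norm_num) h
    · exact hne (4 * j' + 4) (by rw [(nine_X_at (n := N) (by omega)).1, (nine_X_at_of_lt hlt (n := N) (by omega)).1]; norm_num) h.symm
  have hinj₂ : Set.InjOn (nineB N) ↑(range (k - 1)) := by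
    intro j hj j' hj' h
    rw [Finset.mem_coe, Finset.mem_range] at hj hj'
    by_contra hjj
    rcases Nat.lt_or_gt_of_ne hjj with hlt | hlt
    · exact hne (4 * j + 4) (by rw [(nine_X_at (n := N) (by omega)).2, (nine_X_at_of_lt hlt (n := N) (by omega)).2]; norm_num) h
    · exact hne (4 * j' + 4) (by rw [(nine_X_at (n := N) (by omega)).2, (nine_X_at_of_lt hlt (n := N) (by omega)).2]; norm_num) h.symm
  have hdisj : Disjoint S₁ S₂ := by
    rw [Finset.disjoint_left]
    intro ω h1 h2
    obtain ⟨j, hj, rfl⟩ := Finset.mem_image.1 h1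
    obtain ⟨j', hj', h⟩ := Finset.mem_image.1 h2
    rw [Finset.mem_range] at hj hj'
    rcases lt_trichotomy j j' with hlt | rfl | hlt
    · exact hne (4 * j + 4) (by rw [(nine_X_at (n := N) (by omega)).1, (nine_X_at_of_lt hlt (n := N) (by omega)).2]; norm_num) h.symm
    · exact hne (4 * j + 4) (by rw [(nine_X_at (n := N) (by omega)).1, (nine_X_at (n := N) (by omega)).2]; norm_num) h.symm
    · exact hne (4 * j' + 4) (by rw [(nine_X_at (n := N) (by omega)).2, (nine_X_at_of_lt hlt (n := N) (by omega)).1]; norm_num) h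
  have hsub : S₁ ∪ S₂ ⊆ wb N := by
    intro ω hω
    rcases Finset.mem_union.1 hω with h | h
    · obtain ⟨j, hj, rfl⟩ := Finset.mem_image.1 h
      exact nineA_mem_wb (by rw [Finset.mem_range] at hj; omega)
    · obtain ⟨j, hj, rfl⟩ := Finset.mem_image.1 h
      exact nineB_mem_wb (by rw [Finset.mem_range] at hj; omega)
  have hv₁ : ∀ j ∈ range (k - 1), y ^ visits N (nineA N j) = y ^ (2 * k) := fun j hj => by
    rw [Finset.mem_range] at hj; rw [hN, (visits_nine (k := k) (j := j) (by omega)).1]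
  have hv₂ : ∀ j ∈ range (k - 1), y ^ visits N (nineB N j) = y ^ (2 * k) := fun j hj => by
    rw [Finset.mem_range] at hj; rw [hN, (visits_nine (k := k) (j := j) (by omega)).2]
  have hcard : ((range (k - 1)).card : ℝ) = (k : ℝ) - 1 := by rw [Finset.card_range, Nat.cast_sub hk]; push_cast; ring
  have hsum₁ : ∑ ω ∈ S₁, y ^ visits N ω = ((k : ℝ) - 1) * y ^ (2 * k) := by
    rw [hS₁, Finset.sum_image hinj₁, Finset.sum_congr rfl hv₁, Finset.sum_const, nsmul_eq_mul, hcard]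
  have hsum₂ : ∑ ω ∈ S₂, y ^ visits N ω = ((k : ℝ) - 1) * y ^ (2 * k) := by
    rw [hS₂, Finset.sum_image hinj₂, Finset.sum_congr rfl hv₂, Finset.sum_const, nsmul_eq_mul, hcard]
  calc 2 * ((k : ℝ) - 1) * y ^ (2 * k) = ∑ ω ∈ S₁, y ^ visits N ω + ∑ ω ∈ S₂, y ^ visits N ω := by rw [hsum₁, hsum₂]; ring
    _ = ∑ ω ∈ S₁ ∪ S₂, y ^ visits N ω := (Finset.sum_union hdisj).symm
    _ ≤ WB N y := Finset.sum_le_sum_of_subset_of_nonneg hsub fun _ _ _ => pow_nonneg hy _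

/-- ★ The census face `B^w_11(y) ≥ 2y⁴` (a-ref-1: `= 2y⁴`). [cite: Beaton2014RotatedHoneycomb, §3.1 (arXiv v3 p. 12)] -/
theorem two_mul_pow_four_le_WB_eleven (hy : 0 ≤ y) : 2 * y ^ 4 ≤ WB 11 y := by
  have h := WB_ge_nine_defect hy 2
  norm_num at h
  linarith

end Defect

end Literature.Probability.RandomPlanarGeometry.SAW.HexBW.Arm

/-! ### §7  Transfer of the lower bound to Beaton's `μ_rot(y) = HV.rotSurfaceMu y` (`y ≥ 4`) -/

namespace Literature.Probability.RandomPlanarGeometry.SAW.HV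

open Literature.Probability.RandomPlanarGeometry.SAW.HexBW.Arm

variable {y : ℝ}

/-- ★★ **`1 − 2/m − (2m+1)/y² ≤ y (μ_rot(y)² − y)`** for `y ≥ 4`, `m ≥ 2` (`μ_rot = β_rot` there).
[cite: Beaton2014RotatedHoneycomb, Proposition 7 (arXiv v3 p. 11), §3.1 (p. 12)] -/
theorem mul_rotSurfaceMu_sq_sub_ge (hy : 4 ≤ y) {m : ℕ} (hm : 2 ≤ m) :
    1 - 2 / (m : ℝ) - (2 * m + 1) / y ^ 2 ≤ y * (rotSurfaceMu y ^ 2 - y) := by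
  rw [rotSurfaceMu_eq_armRate_of_four_le hy]; exact mul_armRate_sq_sub_ge (by linarith) hm

/-- ★★ **`liminf_{y→∞} y (μ_rot(y)² − y) ≥ 1`**: for every `ε > 0`, eventually `1 − ε ≤ y (μ_rot(y)² − y)`.
[cite: Beaton2014RotatedHoneycomb, Proposition 7 (arXiv v3 p. 11), §3.1 (p. 12)] -/
theorem eventually_mul_rotSurfaceMu_sq_sub_ge {ε : ℝ} (hε : 0 < ε) :
    ∀ᶠ y : ℝ in atTop, 1 - ε ≤ y * (rotSurfaceMu y ^ 2 - y) := by
  filter_upwards [eventually_mul_armRate_sq_sub_ge hε, eventually_ge_atTop (4 : ℝ)] with y h hy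
  rwa [rotSurfaceMu_eq_armRate_of_four_le hy]

end Literature.Probability.RandomPlanarGeometry.SAW.HV
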